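import Literature.NumberTheory.QuadraticFields.JacobiCharacter
import HarnessLib

/-!
# The Jacobi character of an odd squarefree modulus is a primitive quadratic character;
# values of the Kronecker character of an odd fundamental discriminant

Topic `NumberTheory/QuadraticFields` (namespace `Literature.NumberTheory.QuadraticFields`),
continuing `JacobiCharacter.lean` (`jacobiChar q : DirichletCharacter ℂ q`, `n ↦ (n / q)`).
Everything here is PROVED (theorems only, no definitions, no named facts).

* `isQuadratic_jacobiChar` — `jacobiChar q` is a quadratic character (values in `{0, ±1}`);
* `isPrimitive_jacobiChar` — for `q` odd and squarefree, `jacobiChar q` is **primitive** (conductor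
  `q`): if it factored through the conductor `c ≠ q`, pick a prime `ℓ ∣ q / c`; an integer
  `n ≡ 1 (mod q/ℓ)` which is a non-residue mod `ℓ` is a unit `≡ 1 (mod c)` with `(n / q) = −1`
  (Davenport, *Multiplicative Number Theory*, Ch. 5; Montgomery–Vaughan Thm. 9.13: the real
  primitive characters are the Kronecker symbols of fundamental discriminants; here the odd case
  `χ_D = (· / |D|)`, Cox, *Primes of the form x² + ny²*, Lemma 1.14);
* `jacobiChar_neg_one_of_mod_four_eq_three` — `(−1 / q) = −1` for `q ≡ 3 (mod 4)`, i.e.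
  `χ_D(−1) = −1` for a negative odd fundamental discriminant `D = −q`;
* `jacobiChar_natAbs_natCast_eq_one_of_forall_prime` — for `D ≡ 1 (mod 4)` and `N ≥ 1` such that
  every prime `p ∣ N` has `(D / p) = 1` (`p` odd), resp. `D ≡ 1 (mod 8)` (`p = 2`), one has
  `χ_D(N) = (N / |D|) = 1` (complete multiplicativity and `(p / |D|) = (D / p)`,
  `jacobiSym_natAbs_eq_of_emod_four_eq_one`) — the form in which the Heegner hypothesis
  ("every `p ∣ N` splits in `ℚ(√D)`") enters the sign of the functional equation of `L(E/K, s)`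
  (Gross 1984, §5; Darmon 2004, Thm. 3.17).

## References

* [Cox2013] D. A. Cox, *Primes of the form x² + ny²*, 2nd ed. (2013), §1.C Lemma 1.14.
* [MontgomeryVaughan2007] H. L. Montgomery, R. C. Vaughan, *Multiplicative Number Theory I*, CUP
  2007, §9.3, Theorem 9.13.
* H. Davenport, *Multiplicative Number Theory*, 3rd ed., GTM 74 (2000), Ch. 5.
-/

noncomputable section

open scoped NumberTheorySymbols

open DirichletCharacter

namespace Literature.NumberTheory.QuadraticFields

variable {q : ℕ} [NeZero q]

/-! ### `jacobiChar q` is quadratic, and primitive for odd squarefree `q` -/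

/-- The Jacobi character is a quadratic character: its values are `0`, `1`, `−1`. [folklore] -/
theorem isQuadratic_jacobiChar : (jacobiChar q).IsQuadratic := fun a ↦ jacobiChar_trichotomy a

/-- **`jacobiChar q` is primitive for `q` odd and squarefree** (its conductor is `q`): the Kronecker
symbol of an odd fundamental discriminant `D` is a primitive character mod `|D|` (Davenport, Ch. 5;
Montgomery–Vaughan, Thm. 9.13; Cox, Lemma 1.14). Proof: the conductor `c` divides `q` and `χ`
factors through `c`; if `c ≠ q` take a prime `ℓ ∣ q` with `ℓ ∤ c` (so `c ∣ q/ℓ`), a non-residue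
`a` mod `ℓ` and `n ≡ a (mod ℓ)`, `n ≡ 1 (mod q/ℓ)`: then `n` is a unit mod `q` mapping to `1`
mod `c`, yet `(n / q) = (a / ℓ) · (1 / (q/ℓ)) = −1`. [cite: MontgomeryVaughan2007, Theorem 9.13] -/
theorem isPrimitive_jacobiChar (hodd : Odd q) (hsq : Squarefree q) : (jacobiChar q).IsPrimitive := by
  rw [isPrimitive_def]
  set c := (jacobiChar q).conductor with hc
  have hcdvd : c ∣ q := conductor_dvd_level _
  have hft : (jacobiChar q).FactorsThrough c := factorsThrough_conductor _
  by_contra hne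
  -- a prime `ℓ ∣ q` not dividing `c`
  obtain ⟨k, hk⟩ := hcdvd
  have hk1 : k ≠ 1 := fun h ↦ hne (by rw [hk, h, mul_one])
  obtain ⟨ℓ, hℓ, hℓk⟩ := Nat.exists_prime_and_dvd hk1
  have hℓq : ℓ ∣ q := hk ▸ (hℓk.mul_left c)
  have hℓc : ¬ ℓ ∣ c := by
    intro h
    have h2 : ℓ * ℓ ∣ q := hk ▸ mul_dvd_mul h hℓk
    exact hℓ.one_lt.ne' (Nat.isUnit_iff.mp (hsq ℓ h2))
  -- the cofactor `m = q / ℓ` is coprime to `ℓ` and divisible by `c`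
  set m := q / ℓ with hm
  have hqm : q = ℓ * m := (Nat.mul_div_cancel' hℓq).symm
  have hcop : ℓ.Coprime m :=
    Literature.NumberTheory.LFunctions.PrimitiveQuadratic.coprime_div_of_squarefree hsq hℓ hℓq
  have hℓ0 : ℓ ≠ 0 := hℓ.ne_zero
  have hm0 : m ≠ 0 := fun h ↦ NeZero.ne q (by rw [hqm, h, mul_zero])
  have hcm : c ∣ m :=
    (((Nat.Prime.coprime_iff_not_dvd hℓ).mpr hℓc).symm).dvd_of_dvd_mul_left (hqm ▸ ⟨k, hk⟩)
  haveI := Fact.mk hℓ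
  have hℓ2 : ℓ ≠ 2 := by
    rintro rfl
    exact (Nat.not_even_iff_odd.mpr hodd) (even_iff_two_dvd.mpr hℓq)
  -- a non-residue `a` mod `ℓ` and `n ≡ a (mod ℓ)`, `n ≡ 1 (mod m)`
  have hchar : ringChar (ZMod ℓ) ≠ 2 := by rwa [ZMod.ringChar_zmod_n]
  obtain ⟨a, ha⟩ := quadraticChar_exists_neg_one hchar
  have ha0 : a ≠ 0 := by
    rintro rfl
    rw [MulChar.map_zero] at ha
    norm_num at ha
  obtain ⟨n, hn1, hn2⟩ := Nat.chineseRemainder hcop a.val 1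
  have hnℓ : n % ℓ = a.val := by
    rw [show n % ℓ = a.val % ℓ from hn1, Nat.mod_eq_of_lt (ZMod.val_lt a)]
  have hJℓ : J((n : ℤ) | ℓ) = -1 := by
    rw [← jacobiSym_natCast_mod, hnℓ, ← jacobiSym.legendreSym.to_jacobiSym, legendreSym,
      Int.cast_natCast, ZMod.natCast_zmod_val]
    exact ha
  have hJm : J((n : ℤ) | m) = 1 := by
    rw [← jacobiSym_natCast_mod, show n % m = 1 % m from hn2, jacobiSym_natCast_mod, Nat.cast_one,
      jacobiSym.one_left]
  have hJ : jacobiChar q n = -1 := by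
    rw [jacobiChar_natCast, hqm, jacobiSym.mul_right' (n : ℤ) hℓ0 hm0, hJℓ, hJm]
    norm_num
  -- `n` is a unit mod `q` mapping to `1` mod `c` ...
  have hnℓ' : n.Coprime ℓ := by
    refine ((Nat.Prime.coprime_iff_not_dvd hℓ).mpr fun h ↦ ha0 ?_).symm
    rw [← ZMod.val_eq_zero, ← hnℓ]
    exact Nat.mod_eq_zero_of_dvd h
  have hnm : n.Coprime m := (Nat.ModEq.gcd_eq hn2).trans (Nat.gcd_one_left m)
  have hnq : n.Coprime q := hqm ▸ Nat.Coprime.mul_right hnℓ' hnm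
  have hcq : c ∣ q := ⟨k, hk⟩
  have hker := (factorsThrough_iff_ker_unitsMap hcq).mp hft
  have hx : ZMod.unitOfCoprime n hnq ∈ (ZMod.unitsMap hcq).ker := by
    rw [MonoidHom.mem_ker, ZMod.unitsMap_def, Units.ext_iff, Units.coe_map, MonoidHom.coe_coe,
      ZMod.castHom_apply, Units.val_one, ZMod.coe_unitOfCoprime, ZMod.cast_natCast hcq]
    have h := (ZMod.natCast_eq_natCast_iff n 1 c).mpr (Nat.ModEq.of_dvd hcm hn2)
    rwa [Nat.cast_one] at h
  -- ... so `χ(n) = 1`, contradicting `(n / q) = -1`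
  have h1 := hker hx
  rw [MonoidHom.mem_ker, Units.ext_iff, MulChar.coe_toUnitHom, Units.val_one,
    ZMod.coe_unitOfCoprime, hJ] at h1
  norm_num at h1

/-! ### Values of the Kronecker character of an odd fundamental discriminant -/

/-- `(−1 / q) = −1` for `q ≡ 3 (mod 4)`: the Kronecker character `χ_D = (· / |D|)` of a negative
odd fundamental discriminant `D = −q` is odd, `χ_D(−1) = −1` (`jacobiSym.at_neg_one`:
`(−1 / q) = χ₄(q)`). [cite: Cox2013, §1.C Lemma 1.14] -/
theorem jacobiChar_neg_one_of_mod_four_eq_three (hq : q % 4 = 3) : jacobiChar q (-1) = -1 := by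
  have hodd : Odd q := Nat.odd_iff.mpr (by omega)
  have h := jacobiChar_intCast (q := q) (-1)
  rw [Int.cast_neg, Int.cast_one] at h
  rw [h, jacobiSym.at_neg_one hodd, ZMod.χ₄_nat_three_mod_four hq]
  norm_num

/-- For `D ≡ 1 (mod 4)` and an odd prime `p` with `(D / p) = 1`: `χ_D(p) = (p / |D|) = 1`
(`jacobiSym_natAbs_eq_of_emod_four_eq_one`). [cite: Cox2013, §1.C Lemma 1.14] -/
theorem jacobiChar_natAbs_natCast_eq_one_of_prime {D : ℤ} [NeZero D.natAbs] (hD : D % 4 = 1)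
    {p : ℕ} (hp : p.Prime) (hp2 : p ≠ 2) (hJ : J(D | p) = 1) : jacobiChar D.natAbs p = 1 := by
  rw [jacobiChar_natCast, jacobiSym_natAbs_eq_of_emod_four_eq_one hD (hp.odd_of_ne_two hp2), hJ,
    Int.cast_one]

/-- For `D ≡ 1 (mod 8)`: `χ_D(2) = (2 / |D|) = 1` (`jacobiSym_two_natAbs_eq_one_iff`).
[cite: Cox2013, §1.C Lemma 1.14] -/
theorem jacobiChar_natAbs_two_eq_one {D : ℤ} [NeZero D.natAbs] (hD : D % 8 = 1) :
    jacobiChar D.natAbs 2 = 1 := by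
  have h := jacobiChar_natCast (q := D.natAbs) 2
  rw [Nat.cast_ofNat] at h
  rw [h, Nat.cast_ofNat, (jacobiSym_two_natAbs_eq_one_iff (by omega)).mpr hD, Int.cast_one]

/-- **`χ_D(N) = 1` when every prime factor of `N` "splits"**: for `D ≡ 1 (mod 4)` and `N ≠ 0`
such that every prime `p ∣ N` satisfies `D ≡ 1 (mod 8)` if `p = 2` and `(D / p) = 1` if `p` is
odd, `χ_D(N) = (N / |D|) = 1` (complete multiplicativity). With `K = ℚ(√D)` these conditions say
that every `p ∣ N` splits in `K` (the Heegner hypothesis; `satisfiesHeegnerHypothesis_iff_kronecker`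
of `EllipticCurves/HeegnerHypothesisKroneckerProofs.lean`), and `χ_D(N) = 1` is the input
"`ε(ℓ) = 1` for all `ℓ ∣ N`" of Darmon 2004, §3.9 / Thm. 3.17 and Gross 1984, §5.
[cite: Cox2013, §1.C Lemma 1.14] -/
theorem jacobiChar_natAbs_natCast_eq_one_of_forall_prime {D : ℤ} [NeZero D.natAbs] (hD : D % 4 = 1)
    {N : ℕ} (hN : N ≠ 0)
    (h : ∀ p : ℕ, p.Prime → p ∣ N → (p = 2 → D % 8 = 1) ∧ (p ≠ 2 → J(D | p) = 1)) :
    jacobiChar D.natAbs N = 1 := by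
  induction N using Nat.recOnMul with
  | zero => exact absurd rfl hN
  | one => rw [Nat.cast_one, map_one]
  | prime p hp =>
    by_cases hp2 : p = 2
    · subst hp2
      exact jacobiChar_natAbs_two_eq_one ((h 2 Nat.prime_two dvd_rfl).1 rfl)
    · exact jacobiChar_natAbs_natCast_eq_one_of_prime hD hp hp2 ((h p hp dvd_rfl).2 hp2)
  | mul a b iha ihb =>
    have ha : a ≠ 0 := fun h0 ↦ hN (by rw [h0, zero_mul])
    have hb : b ≠ 0 := fun h0 ↦ hN (by rw [h0, mul_zero])
    rw [Nat.cast_mul, map_mul, iha ha fun p hp hpa ↦ h p hp (hpa.mul_right b),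
      ihb hb fun p hp hpb ↦ h p hp (hpb.mul_left a), one_mul]

end Literature.NumberTheory.QuadraticFields

end
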